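import Literature.Analysis.ValidatedNumerics.IntervalGershgorin
import Mathlib.Analysis.Complex.Order
import HarnessLib

/-!
# Witness-free PSD test for complex-interval (Hermitian) matrices via realification

Topic `Literature/Analysis/ValidatedNumerics`. The Hermitian companion of `IntervalGershgorin.lean`: a complex matrix `H = A + iB`
(`A, B` real, `Aᵀ = A`, `Bᵀ = −B`) is positive semidefinite as soon as its realification `[[A, −B], [B, A]]` is
(`posSemidef_ofParts_of_realifyR`, the real-analytic form of `PSDCert.posSemidef_toComplex_of_realify`), and an entrywise enclosure of
`H` by complex boxes `CB` (`Literature.Analysis.ValidatedNumerics.Numerics.CB`, pairs of `FI` intervals) realifies to an `FI` enclosure of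
`[[A, −B], [B, A]]` indexed by `Fin (n + n)` (`realifyI`, `mmem_realifyI`), so that the kernel test `IntervalGershgorin.psdCheck` applies:
`hermPsdCheck CM V = true → CMMem H CM → Hᴴ = H → H.PosSemidef` (`posSemidef_of_hermPsdCheck`). This is the per-corner back-end of
interval eigen-enclosure certificates for Bloch / dynamical matrices evaluated in complex interval arithmetic. No facts, no axioms.

## References
* S. M. Rump, *Verification of positive definiteness*, BIT 46 (2006) 433–452. [folklore]
* R. A. Horn, C. R. Johnson, *Matrix Analysis*, 2nd ed., CUP 2013, §1.3 (real representation of complex matrices). [folklore]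
-/

open Matrix Finset
open scoped ComplexOrder

namespace Literature.Analysis.ValidatedNumerics.IntervalGershgorin

open Literature.Analysis.ValidatedNumerics.Numerics

/-! ### Realification over `ℝ` -/

section Real

variable {ι : Type*} [Fintype ι]

/-- The complex matrix with real part `A` and imaginary part `B`. [folklore] -/
def ofParts (A B : Matrix ι ι ℝ) : Matrix ι ι ℂ := fun i j => ⟨A i j, B i j⟩

/-- The realification `[[A, −B], [B, A]]`. [folklore] -/
def realifyR (A B : Matrix ι ι ℝ) : Matrix (ι ⊕ ι) (ι ⊕ ι) ℝ := fromBlocks A (-B) B A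

/-- `Re ⟨x+iy, (A+iB)(x+iy)⟩ = [x;y]ᵀ [[A,−B],[B,A]] [x;y]`. [folklore] -/
theorem re_form_ofParts (A B : Matrix ι ι ℝ) (x y : ι → ℝ) :
    (star (fun i => (⟨x i, y i⟩ : ℂ)) ⬝ᵥ (ofParts A B) *ᵥ fun i => (⟨x i, y i⟩ : ℂ)).re =
      Sum.elim x y ⬝ᵥ (realifyR A B) *ᵥ Sum.elim x y := by
  simp only [dotProduct, mulVec, ofParts, realifyR, Pi.star_apply, Fintype.sum_sum_type,
    Sum.elim_inl, Sum.elim_inr, fromBlocks_apply₁₁, fromBlocks_apply₁₂, fromBlocks_apply₂₁, fromBlocks_apply₂₂,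
    Complex.re_sum, Complex.mul_re, Complex.star_def, Complex.conj_re, Complex.conj_im,
    Complex.im_sum, Complex.mul_im]
  simp only [neg_mul, sub_neg_eq_add, Finset.sum_add_distrib, Finset.sum_sub_distrib]
  ring_nf
  simp only [Finset.sum_add_distrib, Finset.sum_sub_distrib, Finset.mul_sum]
  ring_nf
  simp only [Matrix.neg_apply, mul_neg, neg_mul, Finset.sum_neg_distrib]
  ring

/-- **PSD of `A + iB` from its realification** (`Aᵀ = A`, `Bᵀ = −B`). [folklore] -/
theorem posSemidef_ofParts_of_realifyR {A B : Matrix ι ι ℝ} (hA : Aᵀ = A) (hB : Bᵀ = -B)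
    (h : (realifyR A B).PosSemidef) : (ofParts A B).PosSemidef := by
  have herm : (ofParts A B).IsHermitian := by
    ext i j
    have h1 : A j i = A i j := by simpa using congrFun (congrFun hA i) j
    have h2 : B j i = -B i j := by simpa using congrFun (congrFun hB i) j
    apply Complex.ext <;> simp [ofParts, h1, h2]
  refine PosSemidef.of_dotProduct_mulVec_nonneg herm fun v => ?_
  have hv : v = fun i => (⟨(v i).re, (v i).im⟩ : ℂ) := by funext i; exact (Complex.eta (v i)).symm
  have hre : 0 ≤ (star v ⬝ᵥ (ofParts A B) *ᵥ v).re := by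
    rw [hv, re_form_ofParts]
    simpa only [star_trivial] using h.dotProduct_mulVec_nonneg (Sum.elim (fun i => (v i).re) fun i => (v i).im)
  have hself : star (star v ⬝ᵥ (ofParts A B) *ᵥ v) = star v ⬝ᵥ (ofParts A B) *ᵥ v := by
    conv_lhs => rw [star_dotProduct, star_star, star_mulVec, herm.eq, ← dotProduct_mulVec]
  have him : (star v ⬝ᵥ (ofParts A B) *ᵥ v).im = 0 := by
    have := congrArg Complex.im hself
    simp only [Complex.star_def, Complex.conj_im] at this
    linarith
  exact Complex.nonneg_iff.2 ⟨hre, him.symm⟩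

/-- Real part of a complex matrix. [folklore] -/
def reM (H : Matrix ι ι ℂ) : Matrix ι ι ℝ := fun i j => (H i j).re

/-- Imaginary part of a complex matrix. [folklore] -/
def imM (H : Matrix ι ι ℂ) : Matrix ι ι ℝ := fun i j => (H i j).im

omit [Fintype ι] in
/-- A complex matrix is `ofParts` of its real and imaginary parts. [folklore] -/
theorem ofParts_reM_imM (H : Matrix ι ι ℂ) : ofParts (reM H) (imM H) = H := by
  funext i j; exact Complex.eta _

omit [Fintype ι] in
/-- For a Hermitian matrix the real part is symmetric and the imaginary part antisymmetric. [folklore] -/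
theorem parts_of_isHermitian {H : Matrix ι ι ℂ} (hH : Hᴴ = H) : (reM H)ᵀ = reM H ∧ (imM H)ᵀ = -imM H := by
  have key : ∀ i j, star (H j i) = H i j := fun i j => by
    simpa [conjTranspose_apply] using congrFun (congrFun hH i) j
  constructor
  · ext i j
    have := congrArg Complex.re (key i j)
    simpa [reM, transpose_apply] using this
  · ext i j
    have := congrArg Complex.im (key i j)
    simp only [Complex.star_def, Complex.conj_im] at this
    simp only [imM, transpose_apply, Matrix.neg_apply]
    linarith

end Real

/-! ### `CB` enclosures and the kernel test -/

/-- Complex-interval matrices with `Fin n` indices. [folklore] -/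
abbrev CMat (n : ℕ) := Fin n → Fin n → CB

/-- Entrywise enclosure of a complex matrix. [folklore] -/
def CMMem {n : ℕ} (H : Matrix (Fin n) (Fin n) ℂ) (CM : CMat n) : Prop := ∀ i j, CB.mem (H i j) (CM i j)

/-- Realification of a `CB` matrix to an `FI` matrix on `Fin (n + n)`: `[[re, −im], [im, re]]` (blocks along `finSumFinEquiv`). [folklore] -/
def realifyI {n : ℕ} (CM : CMat n) : IMat (n + n) := fun a b =>
  match finSumFinEquiv.symm a, finSumFinEquiv.symm b with
  | Sum.inl i, Sum.inl j => (CM i j).re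
  | Sum.inl i, Sum.inr j => (CM i j).im.neg
  | Sum.inr i, Sum.inl j => (CM i j).im
  | Sum.inr i, Sum.inr j => (CM i j).re

/-- The realification of the parts of `H` on `Fin (n + n)` (reindexing `realifyR` along `finSumFinEquiv`). [folklore] -/
def realifyFin {n : ℕ} (H : Matrix (Fin n) (Fin n) ℂ) : Matrix (Fin (n + n)) (Fin (n + n)) ℝ :=
  (realifyR (reM H) (imM H)).submatrix finSumFinEquiv.symm finSumFinEquiv.symm

/-- `realifyI` encloses `realifyFin`. [folklore] -/
theorem mmem_realifyI {n : ℕ} {H : Matrix (Fin n) (Fin n) ℂ} {CM : CMat n} (hH : CMMem H CM) :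
    MMem (realifyFin H) (realifyI CM) := by
  intro a b
  simp only [realifyFin, realifyI, submatrix_apply, realifyR]
  rcases hx : finSumFinEquiv.symm a with i | i <;> rcases hy : finSumFinEquiv.symm b with j | j
  · simpa [reM] using (hH i j).1
  · simpa [imM] using FI.mem_neg (hH i j).2
  · simpa [imM] using (hH i j).2
  · simpa [reM] using (hH i j).1

/-- **The kernel test for a Hermitian matrix enclosed by complex boxes**: `psdCheck` of the realified enclosure. [folklore] -/
def hermPsdCheck {n : ℕ} (CM : CMat n) (V : Fin (n + n) → Fin (n + n) → ℤ) : Bool := psdCheck (realifyI CM) V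

/-- **Soundness of `hermPsdCheck`.** [folklore] -/
theorem posSemidef_of_hermPsdCheck {n : ℕ} {CM : CMat n} {V : Fin (n + n) → Fin (n + n) → ℤ}
    (h : hermPsdCheck CM V = true) {H : Matrix (Fin n) (Fin n) ℂ} (hmem : CMMem H CM) (hH : Hᴴ = H) : H.PosSemidef := by
  obtain ⟨hA, hB⟩ := parts_of_isHermitian hH
  have hsymmR : (realifyR (reM H) (imM H))ᵀ = realifyR (reM H) (imM H) := by
    rw [realifyR, fromBlocks_transpose, hA, hB, transpose_neg, hB, neg_neg]
  have hsymm : (realifyFin H)ᵀ = realifyFin H := by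
    rw [realifyFin, transpose_submatrix, hsymmR]
  have hpsdFin : (realifyFin H).PosSemidef := posSemidef_of_psdCheck h (mmem_realifyI hmem) hsymm
  have hpsdR : (realifyR (reM H) (imM H)).PosSemidef := by
    have := hpsdFin.submatrix finSumFinEquiv
    simpa [realifyFin, submatrix_submatrix] using this
  simpa [ofParts_reM_imM] using posSemidef_ofParts_of_realifyR hA hB hpsdR

end Literature.Analysis.ValidatedNumerics.IntervalGershgorin
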